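import Mathlib
import Summits.NavierStokesRegularity.NavierStokesRegularity.Theorems.TaoLadderRungTwoBreakOneShiftWindowStepSlope
import Summits.NavierStokesRegularity.NavierStokesRegularity.Theorems.TaoLadderRungTwoBreakOneShiftWindowPairDeviation
import HarnessLib

/-!
# The one-shift window system, XVI: the PAIR SLOPE OF ONE STEP, ASSEMBLED — four trajectories (two rough-tail
# runs, their two centre companions), the Jacobians of the two fields on the step hull, the C¹ enclosure of the
# centre step flow and Kapela–Zgliczyński check data give `S_u(h) − S_v(h) = U · (S_u(0) − S_v(0))` with
# `U ∈ [CV − Ẑ, DV + Ẑ]` (cell harvest/h2-tao-ladder, seat p2; rung1/KERNEL-CHEAP-REPLAY-SPEC.md §6 (iii)/(iv),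
# rung1/RUNG1-P2G12-REPORT.md §54 (d); support for K1(1) = `NoSurvivingDSSOne`, stmt-NavierStokesRegularity-20205)

MODEL lattice ODEs only (Tao 2016 §4 normal form on Tao's shift set `S`); nothing here is a statement about
the Navier–Stokes equations; no item is closed; nothing numerical is proved. Generic in the index type `ι`; the
fields are abstract (`f t` = the window field at rough tails, `fc` = at the tube centres); no differentiability of
the rough-tail FLOW is used — only of the fields in the state and of the CENTRE step flow.

* `StepSlopeData ι` — the real data and the three finite checks of one step: centre-Jacobian bounds (`dg`, `R`),
  the affine closeness modulus of the two Jacobians (`Bt` = tail coupling × tube radius on the partner entries,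
  `L` = Lipschitz modulus of the Jacobian rows), the proximity vector `prox` (≥ pair diameters + realisation/centre
  deviation), the a priori pair growth `Wb`, weights `E_i ≥ ∫₀ʰ e^{dg_i r} dr`, the deviation matrix `Ẑ` with the
  K–Z fixed point, and a contraction direction `ζ`;
* `abs_sub_le_of_mem_segment` — a point of a segment is componentwise no farther from an endpoint than the other;
* `exists_stepPairSlope` — THE ASSEMBLY: parts XIV (`exists_slopeMatrix_rows_on_segment`, `exists_slopeMatrix_of_fderiv`,
  `exists_stepSlope`) and XV (`abs_pairDeviation_le`) combined; the per-step hypothesis of part XIII `exists_chainSlope`.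
-/

noncomputable section

-- the sub-problem namespace repeats the summit name by design (D-0017)
set_option linter.dupNamespace false

namespace Summit.NavierStokesRegularity.NavierStokesRegularity.Theorems

namespace DSSOneShift

open Set Metric Filter Topology Literature.Analysis.ODE

variable {ι : Type*} [Fintype ι] [DecidableEq ι]

/-- **The data and finite checks of one step's pair-slope certificate** (what the replay supplies for step `s`:
SPEC §6 (iii)/(iv)). `AΔ_ij = Bt_ij + Σ_k L_ijk prox_k` is the closeness of the rough and centre Jacobian rows.
[cite: KapelaZgliczynski2009, §4 Thm. 9; cell vocabulary, harvest/h2-tao-ladder rung1/KERNEL-CHEAP-REPLAY-SPEC.md §6 (iii)/(iv)] -/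
structure StepSlopeData (ι : Type*) [Fintype ι] where
  /-- step length -/
  h : ℝ
  /-- upper bounds of the diagonal of the centre Jacobian on the hull -/
  dg : ι → ℝ
  /-- bounds of the off-diagonal magnitudes of the centre Jacobian on the hull -/
  R : ι → ι → ℝ
  /-- constant part of the Jacobian closeness (tail coupling × tube radius on the partner entries) -/
  Bt : ι → ι → ℝ
  /-- Lipschitz modulus of the Jacobian rows: `|∂_j f_i(x) − ∂_j fc_i(x')| ≤ Bt_ij + Σ_k L_ijk |x_k − x'_k|` -/
  L : ι → ι → ι → ℝ
  /-- proximity bound of the two row points (pair diameters + realisation/centre deviation) -/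
  prox : ι → ℝ
  /-- a priori growth of the rough pair difference: `|S_u(t) − S_v(t)| ≤ Wb |d|` -/
  Wb : ι → ι → ℝ
  /-- weights `E_i ≥ ∫₀ʰ e^{dg_i r} dr` -/
  E : ι → ℝ
  /-- the deviation matrix -/
  Zh : ι → ι → ℝ
  /-- a contraction direction -/
  ζ : ι → ℝ
  h_nonneg : 0 ≤ h
  R_nonneg : ∀ i j, 0 ≤ R i j
  Bt_nonneg : ∀ i j, 0 ≤ Bt i j
  L_nonneg : ∀ i j k, 0 ≤ L i j k
  prox_nonneg : ∀ k, 0 ≤ prox k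
  Wb_nonneg : ∀ i j, 0 ≤ Wb i j
  Zh_nonneg : ∀ i j, 0 ≤ Zh i j
  ζ_pos : ∀ i, 0 < ζ i
  E_ge : ∀ i, gronwallBound 0 (dg i) 1 h ≤ E i
  /-- the K–Z matrix fixed point with `AΔ = Bt + L·prox` -/
  fix : ∀ i l, ((∑ j, R i j * Zh j l) + ∑ j, (Bt i j + ∑ k, L i j k * prox k) * Wb j l) * E i ≤ Zh i l
  /-- the contraction direction -/
  dir : ∀ i, (∑ j, R i j * ζ j) * E i ≤ ζ i

namespace StepSlopeData

variable (D : StepSlopeData ι)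

/-- The Jacobian closeness `AΔ = Bt + L · prox`. [folklore] -/
def AΔ (i j : ι) : ℝ := D.Bt i j + ∑ k, D.L i j k * D.prox k

omit [DecidableEq ι] in
/-- `AΔ ≥ 0`. [folklore] -/
theorem AΔ_nonneg (i j : ι) : 0 ≤ D.AΔ i j :=
  add_nonneg (D.Bt_nonneg i j) (Finset.sum_nonneg fun k _ => mul_nonneg (D.L_nonneg i j k) (D.prox_nonneg k))

omit [DecidableEq ι] in
/-- The K–Z fixed point in the form of part XV (`AΔ · Wb`). [folklore] -/
theorem fix_AΔ (i l : ι) : ((∑ j, D.R i j * D.Zh j l) + ∑ j, D.AΔ i j * D.Wb j l) * D.E i ≤ D.Zh i l := D.fix i l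

end StepSlopeData

omit [Fintype ι] [DecidableEq ι] in
/-- A point of a segment is componentwise no farther from one endpoint than the other endpoint is. [folklore] -/
theorem abs_sub_le_of_mem_segment {a b z : ι → ℝ} (hz : z ∈ segment ℝ a b) (k : ι) : |z k - b k| ≤ |a k - b k| := by
  obtain ⟨α, β, hα, hβ, hαβ, rfl⟩ := hz
  have e : (α • a + β • b) k - b k = α * (a k - b k) := by
    simp only [Pi.add_apply, Pi.smul_apply, smul_eq_mul]
    have : β = 1 - α := by linarith
    rw [this]; ring
  rw [e, abs_mul, abs_of_nonneg hα]
  have hα1 : α ≤ 1 := by linarith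
  exact mul_le_of_le_one_left (abs_nonneg _) hα1

/-- **THE PAIR SLOPE OF ONE STEP, ASSEMBLED.** Data: a convex step hull `Hs` and a convex start box `X`; the rough
field `f t` and the centre field `fc` with derivatives within `Hs` (`f'`, `fc'`); two rough runs `S_u`, `S_v` on
`[0, h]` from `a, b ∈ X`; the centre solution family `uc` on `X` (`uc x 0 = x`), whose time-`h` map has within `X`
the derivative `Φc' x` with entries in `[CV, DV]` (Literature `hasFDerivWithinAt_flow_of_variationalEnclosure`); all
four trajectories in `Hs` on `[0, h)`; centre-Jacobian bounds `dg`, `R`; the affine closeness of the two Jacobians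
(`Bt`, `L`); the proximity bound `prox_k ≥ |S_u − S_v|_k + |S_v − uc b|_k + |uc a − uc b|_k`; the a priori growth
`|S_u(t) − S_v(t)| ≤ Wb |a − b|` (part XV `abs_pairGrowth_le`); and the checks of `StepSlopeData`. THEN
`S_u(h) − S_v(h) = U · (a − b)` for a real matrix `U ∈ [CV − Ẑ, DV + Ẑ]`. [cite: KapelaZgliczynski2009, §4 Thm. 9; WalawskaWilczak2016, §1.1; cell vocabulary, harvest/h2-tao-ladder rung1/KERNEL-CHEAP-REPLAY-SPEC.md §6 (iii)/(iv)] -/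
theorem exists_stepPairSlope (D : StepSlopeData ι) {Hs X : Set (ι → ℝ)} (hHs : Convex ℝ Hs) (hX : Convex ℝ X)
    {f : ℝ → (ι → ℝ) → ι → ℝ} {f' : ℝ → (ι → ℝ) → (ι → ℝ) →L[ℝ] (ι → ℝ)}
    {fc : (ι → ℝ) → ι → ℝ} {fc' : (ι → ℝ) → (ι → ℝ) →L[ℝ] (ι → ℝ)}
    {uc : (ι → ℝ) → ℝ → ι → ℝ} {Φc' : (ι → ℝ) → (ι → ℝ) →L[ℝ] (ι → ℝ)} {CV DV : ι → ι → ℝ}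
    {Su Sv : ℝ → ι → ℝ} {a b : ι → ℝ} (ha : a ∈ X) (hb : b ∈ X)
    (hSu : ∀ t ∈ Icc 0 D.h, HasDerivWithinAt Su (f t (Su t)) (Icc 0 D.h) t) (hSu0 : Su 0 = a)
    (hSv : ∀ t ∈ Icc 0 D.h, HasDerivWithinAt Sv (f t (Sv t)) (Icc 0 D.h) t) (hSv0 : Sv 0 = b)
    (huc : ∀ x ∈ X, ∀ t ∈ Icc 0 D.h, HasDerivWithinAt (uc x) (fc (uc x t)) (Icc 0 D.h) t)
    (huc0 : ∀ x ∈ X, uc x 0 = x)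
    (hmem : ∀ t ∈ Ico 0 D.h, Su t ∈ Hs ∧ Sv t ∈ Hs ∧ uc a t ∈ Hs ∧ uc b t ∈ Hs)
    (hf : ∀ t ∈ Ico 0 D.h, ∀ x ∈ Hs, HasFDerivWithinAt (f t) (f' t x) Hs x)
    (hfc : ∀ x ∈ Hs, HasFDerivWithinAt fc (fc' x) Hs x)
    (hdg : ∀ x ∈ Hs, ∀ i, (fc' x) (Pi.single i 1) i ≤ D.dg i)
    (hR : ∀ x ∈ Hs, ∀ i j, i ≠ j → |(fc' x) (Pi.single j 1) i| ≤ D.R i j)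
    (hclose : ∀ t ∈ Ico 0 D.h, ∀ x ∈ Hs, ∀ x' ∈ Hs, ∀ i j,
      |(f' t x) (Pi.single j 1) i - (fc' x') (Pi.single j 1) i| ≤ D.Bt i j + ∑ k, D.L i j k * |x k - x' k|)
    (hprox : ∀ t ∈ Ico 0 D.h, ∀ k,
      |Su t k - Sv t k| + |Sv t k - uc b t k| + |uc a t k - uc b t k| ≤ D.prox k)
    (hWb : ∀ t ∈ Ico 0 D.h, ∀ j, |Su t j - Sv t j| ≤ ∑ l, D.Wb j l * |a l - b l|)
    (hΦ : ∀ x ∈ X, HasFDerivWithinAt (fun x' => uc x' D.h) (Φc' x) X x)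
    (hΦenc : ∀ x ∈ X, ∀ i j, CV i j ≤ (Φc' x) (Pi.single j 1) i ∧ (Φc' x) (Pi.single j 1) i ≤ DV i j) :
    ∃ U : Matrix ι ι ℝ, (∀ i j, CV i j - D.Zh i j ≤ U i j ∧ U i j ≤ DV i j + D.Zh i j) ∧
      Su D.h - Sv D.h = U.mulVec (a - b) := by
  classical
  -- the two pair differences and their derivatives
  set w : ℝ → ι → ℝ := fun t => Su t - Sv t with hw
  set wc : ℝ → ι → ℝ := fun t => uc a t - uc b t with hwc
  set w' : ℝ → ι → ℝ := fun t => f t (Su t) - f t (Sv t) with hw'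
  set wc' : ℝ → ι → ℝ := fun t => fc (uc a t) - fc (uc b t) with hwc'
  have hwd : ∀ t ∈ Icc 0 D.h, HasDerivWithinAt w (w' t) (Icc 0 D.h) t := fun t ht => (hSu t ht).sub (hSv t ht)
  have hwcd : ∀ t ∈ Icc 0 D.h, HasDerivWithinAt wc (wc' t) (Icc 0 D.h) t := fun t ht =>
    (huc a ha t ht).sub (huc b hb t ht)
  have hw0 : w 0 = a - b := by simp [hw, hSu0, hSv0]
  have hwc0 : wc 0 = a - b := by simp [hwc, huc0 a ha, huc0 b hb]
  -- the slope structure at each time: row-wise slope matrices of the two fields on the two segments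
  have hstruct : ∀ t ∈ Ico 0 D.h, ∃ A Ac : Matrix ι ι ℝ,
      w' t = A.mulVec (w t) ∧ wc' t = Ac.mulVec (wc t) ∧ (∀ i, Ac i i ≤ D.dg i) ∧
      (∀ i j, i ≠ j → |Ac i j| ≤ D.R i j) ∧ (∀ i j, |A i j - Ac i j| ≤ D.AΔ i j) := by
    intro t ht
    obtain ⟨hSuH, hSvH, huaH, hubH⟩ := hmem t ht
    obtain ⟨z, hz, hzrep⟩ := exists_slopeMatrix_rows_on_segment hHs (hf t ht) hSuH hSvH
    obtain ⟨z', hz', hz'rep⟩ := exists_slopeMatrix_rows_on_segment hHs hfc huaH hubH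
    have hzH : ∀ i, z i ∈ Hs := fun i => hHs.segment_subset hSuH hSvH (hz i)
    have hz'H : ∀ i, z' i ∈ Hs := fun i => hHs.segment_subset huaH hubH (hz' i)
    refine ⟨Matrix.of fun i j => (f' t (z i)) (Pi.single j 1) i,
      Matrix.of fun i j => (fc' (z' i)) (Pi.single j 1) i, hzrep, hz'rep, fun i => hdg (z' i) (hz'H i) i,
      fun i j hij => hR (z' i) (hz'H i) i j hij, fun i j => ?_⟩
    simp only [Matrix.of_apply, StepSlopeData.AΔ]
    refine (hclose t ht (z i) (hzH i) (z' i) (hz'H i) i j).trans (add_le_add le_rfl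
      (Finset.sum_le_sum fun k _ => mul_le_mul_of_nonneg_left ?_ (D.L_nonneg i j k)))
    have h1 := abs_sub_le_of_mem_segment (hz i) k
    have h2 := abs_sub_le_of_mem_segment (hz' i) k
    have h3 := hprox t ht k
    have t1 := abs_sub_le (z i k) (Sv t k) (z' i k)
    have t2 := abs_sub_le (Sv t k) (uc b t k) (z' i k)
    rw [abs_sub_comm (uc b t k) (z' i k)] at t2
    linarith
  -- the a priori growth in the form of part XV
  have hapriori : ∀ t ∈ Ico 0 D.h, ∀ j, |w t j| ≤ ∑ l, D.Wb j l * |(a - b) l| := fun t ht j => by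
    simpa [hw] using hWb t ht j
  -- the deviation bound (part XV)
  have hdev := abs_pairDeviation_le D.h_nonneg hwd hwcd hw0 hwc0 D.R_nonneg D.AΔ_nonneg D.Wb_nonneg D.Zh_nonneg
    hstruct hapriori D.E_ge D.fix_AΔ D.ζ_pos D.dir D.h ⟨D.h_nonneg, le_rfl⟩
  -- the centre slope (part XIV) and the assembly
  obtain ⟨M, hM, hMrep⟩ := exists_slopeMatrix_of_fderiv hX hΦ hΦenc ha hb
  obtain ⟨U, hU, hUrep⟩ := exists_stepSlope (a - b) (w D.h) (wc D.h) hM (by simpa [hwc] using hMrep)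
    D.Zh_nonneg hdev
  exact ⟨U, hU, by simpa [hw] using hUrep⟩

end DSSOneShift

end Summit.NavierStokesRegularity.NavierStokesRegularity.Theorems
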